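import Summits.BirchSwinnertonDyer.BirchSwinnertonDyer.Theses.SignedBaseChange
import Summits.BirchSwinnertonDyer.Rank1Residual.Supersingular.TwistStability
import Summits.BirchSwinnertonDyer.Rank1Residual.Supersingular.KobayashiMainConjectureX7
import Literature.NumberTheory.EllipticCurves.BurungaleSkinnerTianWan2024.OrdinaryMainStatementTwistOfSkinnerUrbanProofs
import Literature.NumberTheory.EllipticCurves.BurungaleSkinnerTianWan2024.GreenbergLFunctionSupersingularExistsPRE
import HarnessLib

/-!
# K2R `SignedDescentFromGreenbergFrames` (route SignedBaseChange, crux stmt-BirchSwinnertonDyer-20087): the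
# twist pair's Katz / Greenberg frames EXIST under F, and K1's `∀`-over-frames package yields an ACTUAL product
# inclusion (helpers `--supports`, prover seat `bsd-wall-sbc-p2`)

K2R = `thm41 → thm12 → F → ∀ (W, p ≥ 5, X7, Surj), Package(K, d, W', ∀ frames (LK, G, G') ∀ J, ∃ s ≠ 0,
(C s)·ch(X_Gr(W/K))·ch(X_Gr(W'/K)) ⊆ (G·G')) → ∀ ε, KobayashiMainConjecture W p ε`, with F =
`GreenbergFramesAtSupersingular` (split child 20086). WHY THIS FILE: K2 was split into F + K2R precisely because
K1's package quantifies `∀` over frames and is vacuous where no frame exists; this file performs the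
instantiation HONESTLY for the twist PAIR — F must be applied to `W` AND to the minimal model `W'` of `W^{(d)}`,
which needs the twist's arithmetic at `p` and at the primes of `D_K`:

* §1 `hasGoodReductionAtPrime_of_smul_eq_quadraticTwist_of_not_ramifiedInQuadratic` — good reduction passes to
  a twist at every prime UNRAMIFIED in `ℚ(√d)` (incl. `ℓ = 2`, `d ≡ 1 (4)`; twist model `k = (d−1)/4`, as the
  tree's `ram_of_smul_eq_quadraticTwist_of_not_ramifiedInQuadratic`); `isCoprime_conductorNorm_twist_discr` —
  `(N_{W'}, D_K) = 1` from `(N_W, D_K) = 1` and the admissibility of `d`;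
* §2 `exists_structureMap` — a structure map `J : ℤ_p →+* 𝒪_{ℂ_p}` compatible with `ℤ_p ⊂ ℚ_p ⊂ ℂ_p` exists;
* §3 `exists_frames_twistPair` — granted F: ONE Katz frame `LK` with Greenberg frames `G` (for `f_W`) and `G'`
  (for `f_{W'}`); the twist is good supersingular at `p` with `a_p(W') = (d/p)·a_p(W) = 0` (`TwistStability`);
* §4 `exists_productInclusion_of_frames` — the package's last conjunct at these frames and this `J`: an actual
  `s ≠ 0` with `(C s)·Π ⊆ (G·G')`, the starting object of the signed descent (stub `stub_signedLowerDescent`).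

* §5 (appended after the F-repair) `exists_frames_twistPair_of_commonFrame` — the same for K2R′ (stmt-…-20417) from
  the cite-only PRE binder GSF, via the typer's `exists_commonKatzFrame_greenberg_pair`.

Nothing here is conditional except on F resp. GSF (binders of K2R resp. K2R′ themselves). Companion file `SignedBaseChangeK2RSqueeze.lean`:
the squeeze (Eisenstein half + Kato + period unit ⇒ KMC) and the reduction of K2R to its Eisenstein half.
References: [SilvermanAEC2009] VII.1 Prop. 1.3, VII.5 Prop. 5.1; [Knapp1993] Prop. 12.10;
[BurungaleSkinnerTianWan2024] §5.4, Thm. 5.11, Thm. 9.24 (shapes only; nothing of the preprint is asserted).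
-/

set_option autoImplicit false

noncomputable section

open scoped Classical MatrixGroups ModularForm

open CongruenceSubgroup WeierstrassCurve Literature.NumberTheory.EllipticCurves
  Literature.NumberTheory.EllipticCurves.ModularForms
  Literature.NumberTheory.EllipticCurves.Rank1Residual
  Literature.NumberTheory.EllipticCurves.BurungaleSkinnerTianWan2024
  IsDedekindDomain Rat.HeightOneSpectrum

namespace Summit.BirchSwinnertonDyer.BirchSwinnertonDyer.Theorems.SignedBaseChangeK2RFrames

/-! ## §1. Arithmetic of the twist `W'` (`C • W' = W^{(d)}`) at primes unramified in `ℚ(√d)` -/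

/-- **Good reduction is inherited by a quadratic twist UNRAMIFIED at the prime.** Let `W₀, W/ℚ` be globally
minimal, `W₀` elliptic, `C • W = W₀^{(d)}` (`d` an integer), and `ℓ` a prime of good reduction of `W₀` at which
`ℚ(√d)` is unramified (`¬ RamifiedInQuadratic d ℓ`: `ℓ ∤ d`, and `d ≡ 1 (mod 4)` if `ℓ = 2`). Then `W` has good
reduction at `ℓ`. Proof (as the tree's `ram_of_smul_eq_quadraticTwist_of_not_ramifiedInQuadratic`, Silverman *AEC*
VII.1 Prop. 1.3, VII.5 Prop. 5.1(a)): with `k = (d-1)/4`, `|k|_ℓ ≤ 1`, `|4k+1|_ℓ = 1`, the integral twist model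
`W₀.twistModel k` is a `ℚ`-model of `E₀^{(d)}` with the same `ord_ℓ Δ_min` as `W₀` (`ordMinimalDiscriminant_twistModel`),
and `ord_ℓ Δ_min` is a `ℚ`-isomorphism invariant; good reduction is `ord_ℓ Δ_min = 0`.
[cite: SilvermanAEC2009, VII.1 Prop. 1.3(b) and VII.5 Prop. 5.1(a)] -/
theorem hasGoodReductionAtPrime_of_smul_eq_quadraticTwist_of_not_ramifiedInQuadratic
    (W₀ W : WeierstrassCurve ℚ) [W₀.IsElliptic] [W₀.IsGloballyMinimal] [W.IsElliptic]
    [W.IsGloballyMinimal] {d : ℤ} {C : VariableChange ℚ}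
    (hC : C • W = W₀.quadraticTwist (d : ℚ)) {ℓ : ℕ} (hℓ : ℓ.Prime)
    (hgood : haveI := Fact.mk hℓ; W₀.HasGoodReductionAtPrime ℓ) (hunr : ¬ RamifiedInQuadratic d ℓ) :
    haveI := Fact.mk hℓ; W.HasGoodReductionAtPrime ℓ := by
  haveI : Fact ℓ.Prime := ⟨hℓ⟩
  -- the place `u` of `ℤ` below `ℓ`
  set u : HeightOneSpectrum ℤ := (primesEquiv (R := ℤ)).symm ⟨ℓ, hℓ⟩ with hu
  have hpu : primesEquiv u = ⟨ℓ, hℓ⟩ := (primesEquiv (R := ℤ)).apply_symm_apply ⟨ℓ, hℓ⟩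
  have hℓu : natGenerator u = ℓ := congrArg Subtype.val hpu
  -- `ℓ` unramified in `ℚ(√d)`: `ℓ ∤ d`, and `4 ∣ d - 1` if `ℓ = 2`
  have hℓd : ¬ (ℓ : ℤ) ∣ d := fun h ↦ hunr (Or.inl h)
  have h2 : ℓ = 2 → d % 4 = 1 := fun h ↦ by
    by_contra h4
    exact hunr (Or.inr ⟨h, h4⟩)
  -- the twisting parameter `k = (d - 1)/4`, `4k + 1 = d`
  set k : ℚ := ((d : ℚ) - 1) / 4 with hk
  have hk4 : 4 * k + 1 = (d : ℚ) := by rw [hk]; ring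
  have hvd : u.valuation ℚ (4 * k + 1) = 1 := by
    rw [hk4, show ((d : ℚ)) = algebraMap ℤ ℚ d from rfl, HeightOneSpectrum.valuation_of_algebraMap]
    exact intValuation_eq_one_of_not_dvd u (by rwa [hℓu])
  have hvk : u.valuation ℚ k ≤ 1 := by
    rcases eq_or_ne ℓ 2 with h | h
    · have h4 : (4 : ℤ) ∣ d - 1 := by
        have := h2 h
        omega
      obtain ⟨m, hm⟩ := h4
      have hkm : k = (m : ℚ) := by
        rw [hk]
        have : ((d : ℚ) - 1) = 4 * (m : ℚ) := by exact_mod_cast hm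
        rw [this]; ring
      rw [hkm, show ((m : ℚ)) = algebraMap ℤ ℚ m from rfl, HeightOneSpectrum.valuation_of_algebraMap]
      exact HeightOneSpectrum.intValuation_le_one u m
    · have h4u : u.valuation ℚ (4 : ℚ) = 1 := by
        rw [show (4 : ℚ) = algebraMap ℤ ℚ 4 from by norm_num, HeightOneSpectrum.valuation_of_algebraMap]
        refine intValuation_eq_one_of_not_dvd u ?_
        rw [hℓu]
        intro h4
        have h22 : (ℓ : ℤ) ∣ 2 * 2 := by simpa using h4
        rcases (Int.Prime.dvd_mul' hℓ h22) with h' | h' <;>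
        · have : ℓ ∣ 2 := by exact_mod_cast h'
          exact h ((Nat.prime_dvd_prime_iff_eq hℓ Nat.prime_two).mp this)
      have hd1 : u.valuation ℚ ((d : ℚ) - 1) ≤ 1 := by
        rw [show ((d : ℚ) - 1) = algebraMap ℤ ℚ (d - 1) from by push_cast; rfl,
          HeightOneSpectrum.valuation_of_algebraMap]
        exact HeightOneSpectrum.intValuation_le_one u _
      rw [hk, map_div₀, h4u, div_one]
      exact hd1
  -- the integral twist model is a `ℚ`-model of `E₀^{(d)}`, hence `ℚ`-isomorphic to `W`
  obtain ⟨C', -, hC'⟩ := W₀.exists_variableChange_twistModel_eq_quadraticTwist k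
  rw [hk4, ← hC] at hC'
  have hW : W = (C⁻¹ * C') • W₀.twistModel k := by rw [mul_smul, hC', inv_smul_smul]
  -- `ord_ℓ Δ_min`: `W` = twist model = `W₀`
  have hordW : W.ordMinimalDiscriminant u = W₀.ordMinimalDiscriminant u := by
    rw [hW, ordMinimalDiscriminant_smul_holds u (W₀.twistModel k) (C⁻¹ * C'),
      ordMinimalDiscriminant_twistModel u W₀ hvk hvd]
  -- good reduction ↔ `ord Δ_min = 0`
  have h0 : W₀.ordMinimalDiscriminant u = 0 := by
    have hg : W₀.HasGoodReductionAt u := by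
      have h := hasGoodReductionAtPrime_primesEquiv_iff_hasGoodReductionAt W₀ u
      rw [hpu] at h
      exact h.mp hgood
    exact (ordMinimalDiscriminant_eq_zero_iff_holds u W₀).mpr hg
  have hgW : W.HasGoodReductionAt u :=
    (ordMinimalDiscriminant_eq_zero_iff_holds u W).mp (by rw [hordW, h0])
  have h := hasGoodReductionAtPrime_primesEquiv_iff_hasGoodReductionAt W u
  rw [hpu] at h
  exact h.mpr hgW

/-- **The conductor of an admissible twist is prime to `D_K`.** If `C • W' = W^{(d)}` with every prime
ramified in `ℚ(√d)` prime to `N = N_W` and to `D = disc K`, and `(N, D) = 1`, then `(N', D) = 1` for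
`N' = N_{W'}`: a prime `q ∣ N'` is a bad prime of `W'`, hence (by
`hasGoodReductionAtPrime_of_smul_eq_quadraticTwist_of_not_ramifiedInQuadratic`) either ramified in `ℚ(√d)` or
a bad prime of `W`, and in both cases `q ∤ D`. [cite: SilvermanAEC2009, VII.5 Prop. 5.1(a)] -/
theorem isCoprime_conductorNorm_twist_discr (W W' : WeierstrassCurve ℚ) [W.IsElliptic]
    [W.IsGloballyMinimal] [W'.IsElliptic] [W'.IsGloballyMinimal] {d : ℤ} {C : VariableChange ℚ}
    (hC : C • W' = W.quadraticTwist (d : ℚ)) {N N' : ℕ} (hN : (N : ℤ) = W.conductorNorm ℤ)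
    (hN' : (N' : ℤ) = W'.conductorNorm ℤ) {D : ℤ}
    (hram : ∀ q : ℕ, q.Prime → RamifiedInQuadratic d q → ¬ q ∣ N ∧ ¬ (q : ℤ) ∣ D)
    (hND : IsCoprime (N : ℤ) D) : IsCoprime (N' : ℤ) D := by
  have hNn : N = W.conductorNorm ℤ := by exact_mod_cast hN
  have hN'n : N' = W'.conductorNorm ℤ := by exact_mod_cast hN'
  rw [Int.isCoprime_iff_gcd_eq_one, Int.gcd_eq_natAbs, Int.natAbs_natCast]
  refine Nat.coprime_of_dvd fun q hq hqN' hqD ↦ ?_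
  haveI : Fact q.Prime := ⟨hq⟩
  -- `q ∣ N'`: `q` is a bad prime of `W'`
  have hbad : ¬ W'.HasGoodReductionAtPrime q :=
    (W'.dvd_conductorNorm_iff_not_hasGoodReductionAtPrime q).mp (hN'n ▸ hqN')
  by_cases hr : RamifiedInQuadratic d q
  · -- ramified in `ℚ(√d)`: `q ∤ D` by hypothesis
    exact (hram q hq hr).2 (Int.ofNat_dvd_left.mpr hqD)
  · -- unramified: then `q` is a bad prime of `W`, contradicting `(N, D) = 1`
    have hbadW : ¬ W.HasGoodReductionAtPrime q := fun hg ↦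
      hbad (hasGoodReductionAtPrime_of_smul_eq_quadraticTwist_of_not_ramifiedInQuadratic W W' hC hq hg hr)
    have hqN : (q : ℤ) ∣ (N : ℤ) := by
      rw [hNn]
      exact Int.natCast_dvd_natCast.mpr ((W.dvd_conductorNorm_iff_not_hasGoodReductionAtPrime q).mpr hbadW)
    have hu := hND.isUnit_of_dvd' hqN (Int.ofNat_dvd_left.mpr hqD)
    rw [Int.isUnit_iff_natAbs_eq, Int.natAbs_natCast] at hu
    exact hq.one_lt.ne' hu

/-- `p ∤ d` for an admissible twisting parameter: a prime dividing `d` ramifies in `ℚ(√d)`.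
[cite: BurungaleSkinnerTianWan2024, Thm. 1.3 twist clause (shape of `RamifiedInQuadratic`)] -/
theorem not_dvd_of_ramified_ne {d : ℤ} {p : ℕ} (hp : p.Prime)
    (hram : ∀ q : ℕ, q.Prime → RamifiedInQuadratic d q → q ≠ p) : ¬ (p : ℤ) ∣ d :=
  fun h ↦ hram p hp (Or.inl h) rfl

/-- For an odd prime `p ∤ d`: `p ∤ 2d`. [folklore] -/
theorem not_dvd_two_mul {d : ℤ} {p : ℕ} (hp : p.Prime) (hp2 : p ≠ 2) (hpd : ¬ (p : ℤ) ∣ d) :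
    ¬ (p : ℤ) ∣ 2 * d := by
  intro h
  rcases (Nat.prime_iff_prime_int.mp hp).dvd_or_dvd h with h2 | hd
  · have : p ∣ 2 := by exact_mod_cast h2
    exact hp2 ((Nat.prime_dvd_prime_iff_eq hp Nat.prime_two).mp this)
  · exact hpd hd

/-! ## §2. A structure map `J : ℤ_p → 𝒪_{ℂ_p}` compatible with `ℤ_p ⊂ ℚ_p ⊂ ℂ_p` -/

/-- On `ℂ_p` the norm is the valuation read in `ℝ`. [folklore] -/
theorem norm_eq_coe_valuation (p : ℕ) [Fact p.Prime] (x : PadicComplex p) :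
    ‖x‖ = ((Valued.v x : NNReal) : ℝ) := by
  rw [PadicComplex.norm_eq_norm, Valuation.norm_def, PadicComplex.RankOne.hom_eq_embedding,
    Valuation.embedding_restrict]

/-- **A structure map `J : ℤ_p →+* 𝒪_{ℂ_p}` exists** (the restriction of `ℤ_p → ℚ_p → ℂ_p` to the unit ball),
compatible with the inclusions — the `J` over which K1's package and BSTW's `toUnr₂` quantify. [folklore] -/
theorem exists_structureMap (p : ℕ) [Fact p.Prime] :
    ∃ J : ℤ_[p] →+* PadicComplexInt p,
      ∀ x : ℤ_[p], ((J x : PadicComplexInt p) : PadicComplex p) = ((x : ℚ_[p]) : PadicComplex p) := by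
  have hmem : ∀ x : ℤ_[p], ((x : ℚ_[p]) : PadicComplex p) ∈ PadicComplexInt p := by
    intro x
    rw [PadicComplexInt, Valuation.mem_valuationSubring_iff]
    have h : ‖((x : ℚ_[p]) : PadicComplex p)‖ ≤ 1 := by
      rw [PadicComplex.norm_extends']; exact PadicInt.norm_le_one x
    rw [norm_eq_coe_valuation] at h
    exact_mod_cast h
  exact ⟨((algebraMap ℚ_[p] (PadicComplex p)).comp PadicInt.Coe.ringHom).codRestrict (PadicComplexInt p)
    fun x ↦ hmem x, fun x ↦ rfl⟩

/-! ## §3. The twist pair's Katz frame and Greenberg frames exist (F instantiated for `W` and for `W'`) -/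

open Summit.BirchSwinnertonDyer.BirchSwinnertonDyer.Theses.SignedBaseChange in
/-- **F instantiated on both members of the twist pair.** Granted F = `GreenbergFramesAtSupersingular`, for an X7
pair `(W, p)` with `p ≥ 5` (so `a_p = 0`, `p ∤ N`), `K` imaginary quadratic with `p = v v̄` split, `(N, D_K) = 1`, the
cyclotomic/anticyclotomic tower, and an admissible twist `W'` of `W` by a square-free `d` (every prime ramified in
`ℚ(√d)` is `≠ p`, `∤ N`, `∤ D_K`): the twist is again good supersingular at `p` with `a_p(W') = (d/p)·0 = 0`
(`TwistStability`), `(N', D_K) = 1` (§1), so F applies to `W'` as well, and ONE Katz frame `LK` carries Greenberg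
frames `G` (for `f = f_W`) and `G'` (for `f' = f_{W'}`). This is the instantiation K2's prover could not do without F.
[cite: BurungaleSkinnerTianWan2024, §5.4 and Thm. 5.11 (shape only; F is a hypothesis)] [cite: Knapp1993, Prop. 12.10] -/
theorem exists_frames_twistPair (hF : GreenbergFramesAtSupersingular) {p : ℕ} [Fact p.Prime]
    (ι : PadicAlgCl p ≃+* ℂ) (W W' : WeierstrassCurve ℚ) [W.IsElliptic] [W.IsGloballyMinimal] [W'.IsElliptic]
    [W'.IsGloballyMinimal] (K : Type) [Field K] [NumberField K]
    (v vbar : HeightOneSpectrum (NumberField.RingOfIntegers K)) (κ₁ κ₂ : ZpExtension K p)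
    (γ₁ γ₂ : Field.absoluteGaloisGroup K) [Fact (ZpExtension.IsTopGeneratorPair κ₁ κ₂ γ₁ γ₂)]
    {N N' : ℕ} [NeZero N] [NeZero N'] {f : CuspForm (Gamma0 N) 2} {f' : CuspForm (Gamma0 N') 2}
    (hf : IsNewformOf W f) (hf' : IsNewformOf W' f') [NeZero (NumberField.discr K).natAbs]
    (hN : (N : ℤ) = W.conductorNorm ℤ) (hN' : (N' : ℤ) = W'.conductorNorm ℤ) (hp5 : 5 ≤ p)
    (hX : ClassX7 W p) {d : ℤ} {C : VariableChange ℚ} (hd : Squarefree d)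
    (hram : ∀ q : ℕ, q.Prime → RamifiedInQuadratic d q → q ≠ p ∧ ¬ q ∣ N ∧ ¬ (q : ℤ) ∣ NumberField.discr K)
    (hC : C • W' = W.quadraticTwist (d : ℚ)) (hK : IsImaginaryQuadratic K)
    (hsplit : ((Ideal.span {(p : ℤ)}).primesOver (NumberField.RingOfIntegers K)).ncard = 2)
    (hv : ((p : ℕ) : NumberField.RingOfIntegers K) ∈ v.asIdeal)
    (hvbar : ((p : ℕ) : NumberField.RingOfIntegers K) ∈ vbar.asIdeal) (hne : vbar ≠ v)
    (hιv : ∀ (w : NumberField.InfinitePlace K) (k : NumberField.RingOfIntegers K),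
      k ∈ v.asIdeal ↔ ‖ι.symm (w.embedding (k : K))‖ < 1)
    (hND : IsCoprime (N : ℤ) (NumberField.discr K)) (hκ₁ : κ₁.IsCyclotomic) (hκ₂ : κ₂.IsAnticyclotomic) :
    ∃ (Ω δ : ℂ) (Ωp : (unrIntegers p)ˣ) (LK G G' : PowerSeries (PowerSeries (PadicComplexInt p))),
      Ω ≠ 0 ∧ (δ ^ 2 = (NumberField.discr K : ℂ) ∨ δ ^ 2 = -(NumberField.discr K : ℂ)) ∧
      IsKatzMeasure₂ ι v vbar ∅ κ₁ κ₂ γ₁⁻¹ γ₂⁻¹ 1 Ω δ ((Ωp : unrIntegers p) : PadicComplex p) LK ∧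
      IsGreenbergLFunctionAnyRoot₂ ι v vbar κ₁ κ₂ γ₁⁻¹ γ₂⁻¹ f (NumberField.discr K).natAbs
        (NumberField.classNumber K) LK G ∧
      IsGreenbergLFunctionAnyRoot₂ ι v vbar κ₁ κ₂ γ₁⁻¹ γ₂⁻¹ f' (NumberField.discr K).natAbs
        (NumberField.classNumber K) LK G' := by
  have hpP : p.Prime := Fact.out
  have hp2 : p ≠ 2 := by omega
  -- `W`: good supersingular at `p ≥ 5`, so `a_p = 0` and `p ∤ N`
  have hgood : W.HasGoodReductionAtPrime p := hX.1.1
  have hap : W.frobeniusTrace p = 0 :=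
    Summit.BirchSwinnertonDyer.Rank1Residual.Supersingular.ClassX7.frobeniusTrace_eq_zero_of_five_le W p hp5 hX
  have hpN : ¬ (p : ℤ) ∣ W.conductorNorm ℤ := fun h ↦
    (W.dvd_conductorNorm_iff_not_hasGoodReductionAtPrime p).mp (by exact_mod_cast h) hgood
  -- `W'`: `p ∤ 2d`, good at `p`, `a_p(W') = 0`, `(N', D_K) = 1`
  have hpd : ¬ (p : ℤ) ∣ d := not_dvd_of_ramified_ne hpP fun q hq hr ↦ (hram q hq hr).1
  have hp2d : ¬ (p : ℤ) ∣ 2 * d := not_dvd_two_mul hpP hp2 hpd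
  have hgood' : W'.HasGoodReductionAtPrime p :=
    Summit.BirchSwinnertonDyer.Rank1Residual.Supersingular.hasGoodReductionAtPrime_of_smul_eq_quadraticTwist
      W W' p hC hp2d hgood
  have hap' : W'.frobeniusTrace p = 0 := by
    rw [Summit.BirchSwinnertonDyer.Rank1Residual.Supersingular.frobeniusTrace_of_smul_eq_quadraticTwist
      W W' p hd hC hp2d hgood, hap, mul_zero]
  have hpN' : ¬ (p : ℤ) ∣ W'.conductorNorm ℤ := fun h ↦
    (W'.dvd_conductorNorm_iff_not_hasGoodReductionAtPrime p).mp (by exact_mod_cast h) hgood'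
  have hND' : IsCoprime (N' : ℤ) (NumberField.discr K) :=
    isCoprime_conductorNorm_twist_discr W W' hC hN hN' (fun q hq hr ↦ (hram q hq hr).2) hND
  -- F for `W` and for `W'`
  obtain ⟨⟨Ω, δ, Ωp, LK, hΩ, hδ, hLK⟩, hG⟩ :=
    hF ι W K v vbar κ₁ κ₂ γ₁ γ₂ hf hN hp5 hpN hap hK hsplit hv hvbar hne hιv hND hκ₁ hκ₂
  obtain ⟨-, hG'⟩ :=
    hF ι W' K v vbar κ₁ κ₂ γ₁ γ₂ hf' hN' hp5 hpN' hap' hK hsplit hv hvbar hne hιv hND' hκ₁ hκ₂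
  obtain ⟨G, hGf⟩ := hG Ω δ Ωp LK hΩ hδ hLK
  obtain ⟨G', hG'f⟩ := hG' Ω δ Ωp LK hΩ hδ hLK
  exact ⟨Ω, δ, Ωp, LK, G, G', hΩ, hδ, hLK, hGf, hG'f⟩

/-! ## §4. K1's package is NON-VACUOUSLY instantiated: an actual product inclusion -/

open Summit.BirchSwinnertonDyer.BirchSwinnertonDyer.Theses.SignedBaseChange in
/-- **The product inclusion at actual frames.** In the setting of `exists_frames_twistPair`, the `∀`-over-frames
conclusion of K1's package (`hall`, verbatim the last conjunct of `TwistPairGreenbergProductDivisibility` /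
the hypothesis of K2R) yields, at the Katz frame and the two Greenberg frames supplied by F and at a structure map
`J` (§2), a non-zero `s ∈ 𝒪_{ℂ_p}⟦T₁⟧` with `(C s) · ch(X_Gr(W/K)) · ch(X_Gr(W'/K)) ⊆ (G · G')` in
`𝒪_{ℂ_p}⟦T₁⟧⟦T₂⟧` — the object the signed descent (stub `stub_signedLowerDescent`) has to start from.
[cite: BurungaleSkinnerTianWan2024, Thm. 9.24 (shape of the conclusion; nothing asserted)] -/
theorem exists_productInclusion_of_frames (hF : GreenbergFramesAtSupersingular) {p : ℕ} [Fact p.Prime]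
    (ι : PadicAlgCl p ≃+* ℂ) (W W' : WeierstrassCurve ℚ) [W.IsElliptic] [W.IsGloballyMinimal] [W'.IsElliptic]
    [W'.IsGloballyMinimal] (K : Type) [Field K] [NumberField K]
    (v vbar : HeightOneSpectrum (NumberField.RingOfIntegers K)) (κ₁ κ₂ : ZpExtension K p)
    (γ₁ γ₂ : Field.absoluteGaloisGroup K) [Fact (ZpExtension.IsTopGeneratorPair κ₁ κ₂ γ₁ γ₂)]
    {N N' : ℕ} [NeZero N] [NeZero N'] {f : CuspForm (Gamma0 N) 2} {f' : CuspForm (Gamma0 N') 2}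
    (hf : IsNewformOf W f) (hf' : IsNewformOf W' f') [NeZero (NumberField.discr K).natAbs]
    (hN : (N : ℤ) = W.conductorNorm ℤ) (hN' : (N' : ℤ) = W'.conductorNorm ℤ) (hp5 : 5 ≤ p)
    (hX : ClassX7 W p) {d : ℤ} {C : VariableChange ℚ} (hd : Squarefree d)
    (hram : ∀ q : ℕ, q.Prime → RamifiedInQuadratic d q → q ≠ p ∧ ¬ q ∣ N ∧ ¬ (q : ℤ) ∣ NumberField.discr K)
    (hC : C • W' = W.quadraticTwist (d : ℚ)) (hK : IsImaginaryQuadratic K)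
    (hsplit : ((Ideal.span {(p : ℤ)}).primesOver (NumberField.RingOfIntegers K)).ncard = 2)
    (hv : ((p : ℕ) : NumberField.RingOfIntegers K) ∈ v.asIdeal)
    (hvbar : ((p : ℕ) : NumberField.RingOfIntegers K) ∈ vbar.asIdeal) (hne : vbar ≠ v)
    (hιv : ∀ (w : NumberField.InfinitePlace K) (k : NumberField.RingOfIntegers K),
      k ∈ v.asIdeal ↔ ‖ι.symm (w.embedding (k : K))‖ < 1)
    (hND : IsCoprime (N : ℤ) (NumberField.discr K)) (hκ₁ : κ₁.IsCyclotomic) (hκ₂ : κ₂.IsAnticyclotomic)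
    (hall : ∀ (Ω δ : ℂ) (Ωp : (unrIntegers p)ˣ) (LK G G' : PowerSeries (PowerSeries (PadicComplexInt p))),
      Ω ≠ 0 → (δ ^ 2 = (NumberField.discr K : ℂ) ∨ δ ^ 2 = -(NumberField.discr K : ℂ)) →
      IsKatzMeasure₂ ι v vbar ∅ κ₁ κ₂ γ₁⁻¹ γ₂⁻¹ 1 Ω δ ((Ωp : unrIntegers p) : PadicComplex p) LK →
      IsGreenbergLFunctionAnyRoot₂ ι v vbar κ₁ κ₂ γ₁⁻¹ γ₂⁻¹ f (NumberField.discr K).natAbs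
        (NumberField.classNumber K) LK G →
      IsGreenbergLFunctionAnyRoot₂ ι v vbar κ₁ κ₂ γ₁⁻¹ γ₂⁻¹ f' (NumberField.discr K).natAbs
        (NumberField.classNumber K) LK G' →
      ∀ J : ℤ_[p] →+* PadicComplexInt p,
        (∀ x : ℤ_[p], ((J x : PadicComplexInt p) : PadicComplex p) = ((x : ℚ_[p]) : PadicComplex p)) →
        ∃ s : PowerSeries (PadicComplexInt p), s ≠ 0 ∧
          Ideal.span {PowerSeries.map (PowerSeries.C (R := PadicComplexInt p)) s} *
              ((WeierstrassCurve.XGr₂.charIdeal (W.baseChange K) p κ₁ κ₂ vbar γ₁ γ₂).map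
                (IwasawaAlgebra₂.toUnr₂ p J) *
              (WeierstrassCurve.XGr₂.charIdeal (W'.baseChange K) p κ₁ κ₂ vbar γ₁ γ₂).map
                (IwasawaAlgebra₂.toUnr₂ p J)) ≤ Ideal.span {G * G'}) :
    ∃ (Ω δ : ℂ) (Ωp : (unrIntegers p)ˣ) (LK G G' : PowerSeries (PowerSeries (PadicComplexInt p)))
      (J : ℤ_[p] →+* PadicComplexInt p) (s : PowerSeries (PadicComplexInt p)),
      IsKatzMeasure₂ ι v vbar ∅ κ₁ κ₂ γ₁⁻¹ γ₂⁻¹ 1 Ω δ ((Ωp : unrIntegers p) : PadicComplex p) LK ∧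
      IsGreenbergLFunctionAnyRoot₂ ι v vbar κ₁ κ₂ γ₁⁻¹ γ₂⁻¹ f (NumberField.discr K).natAbs
        (NumberField.classNumber K) LK G ∧
      IsGreenbergLFunctionAnyRoot₂ ι v vbar κ₁ κ₂ γ₁⁻¹ γ₂⁻¹ f' (NumberField.discr K).natAbs
        (NumberField.classNumber K) LK G' ∧
      (∀ x : ℤ_[p], ((J x : PadicComplexInt p) : PadicComplex p) = ((x : ℚ_[p]) : PadicComplex p)) ∧
      s ≠ 0 ∧
      Ideal.span {PowerSeries.map (PowerSeries.C (R := PadicComplexInt p)) s} *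
          ((WeierstrassCurve.XGr₂.charIdeal (W.baseChange K) p κ₁ κ₂ vbar γ₁ γ₂).map
            (IwasawaAlgebra₂.toUnr₂ p J) *
          (WeierstrassCurve.XGr₂.charIdeal (W'.baseChange K) p κ₁ κ₂ vbar γ₁ γ₂).map
            (IwasawaAlgebra₂.toUnr₂ p J)) ≤ Ideal.span {G * G'} := by
  obtain ⟨Ω, δ, Ωp, LK, G, G', hΩ, hδ, hLK, hG, hG'⟩ := exists_frames_twistPair hF ι W W' K v vbar κ₁ κ₂
    γ₁ γ₂ hf hf' hN hN' hp5 hX hd hram hC hK hsplit hv hvbar hne hιv hND hκ₁ hκ₂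
  obtain ⟨J, hJ⟩ := exists_structureMap p
  obtain ⟨s, hs, hincl⟩ := hall Ω δ Ωp LK G G' hΩ hδ hLK hG hG' J hJ
  exact ⟨Ω, δ, Ωp, LK, G, G', J, s, hLK, hG, hG', hJ, hs, hincl⟩

/-! ## §5 (appended 2026-08-27, after the route's F-repair S1♮: K2R′ `SignedDescentFromCommonFrame`, item
stmt-BirchSwinnertonDyer-20417, antecedent GSF = `GreenbergSupersingularFrameInput` in place of F). The twist pair's
frames over BSTW's COMMON Katz frame -/

/-- **GSF instantiated on both members of the twist pair.** Granted the cite-only PRE binder GSF =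
`BurungaleSkinnerTianWan2024.thm617_exists_commonKatzFrame_isGreenbergLFunctionAnyRoot₂_supersingular_PRE` («∀ K-data ∃
ONE Katz frame ∀ admissible supersingular newform ∃ G»), for an X7 pair `(W, p)` with `p ≥ 5`, `K` imaginary quadratic
with `p = v v̄`, `(N, D_K) = 1`, the cyclotomic/anticyclotomic tower, and an admissible twist `W'` of `W` by a
square-free `d`: over GSF's Katz frame `LK` there are Greenberg frames `G` for `f_W` and `G'` for `f_{W'}` — the typer's
pair lemma `BurungaleSkinnerTianWan2024.exists_commonKatzFrame_greenberg_pair` with its three twist obligations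
(`p ∤ N'`, `a_p(W') = 0`, `(N', D_K) = 1`) DISCHARGED by `TwistStability` and §1. The entry point of K2R′'s descent stub;
with `exists_structureMap` (§2) and K1's `∀`-over-frames clause it yields the actual product inclusion exactly as in §4.
[claim: BurungaleSkinnerTianWan2024, status: under-review] [cite: Knapp1993, Prop. 12.10] -/
theorem exists_frames_twistPair_of_commonFrame
    (hGF : thm617_exists_commonKatzFrame_isGreenbergLFunctionAnyRoot₂_supersingular_PRE) {p : ℕ} [Fact p.Prime]
    (ι : PadicAlgCl p ≃+* ℂ) (W W' : WeierstrassCurve ℚ) [W.IsElliptic] [W.IsGloballyMinimal] [W'.IsElliptic]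
    [W'.IsGloballyMinimal] (K : Type) [Field K] [NumberField K]
    (v vbar : HeightOneSpectrum (NumberField.RingOfIntegers K)) (κ₁ κ₂ : ZpExtension K p)
    (γ₁ γ₂ : Field.absoluteGaloisGroup K) [Fact (ZpExtension.IsTopGeneratorPair κ₁ κ₂ γ₁ γ₂)]
    {N N' : ℕ} [NeZero N] [NeZero N'] {f : CuspForm (Gamma0 N) 2} {f' : CuspForm (Gamma0 N') 2}
    (hf : IsNewformOf W f) (hf' : IsNewformOf W' f') [NeZero (NumberField.discr K).natAbs]
    (hN : (N : ℤ) = W.conductorNorm ℤ) (hN' : (N' : ℤ) = W'.conductorNorm ℤ) (hp5 : 5 ≤ p)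
    (hX : ClassX7 W p) {d : ℤ} {C : VariableChange ℚ} (hd : Squarefree d)
    (hram : ∀ q : ℕ, q.Prime → RamifiedInQuadratic d q → q ≠ p ∧ ¬ q ∣ N ∧ ¬ (q : ℤ) ∣ NumberField.discr K)
    (hC : C • W' = W.quadraticTwist (d : ℚ)) (hK : IsImaginaryQuadratic K)
    (hsplit : ((Ideal.span {(p : ℤ)}).primesOver (NumberField.RingOfIntegers K)).ncard = 2)
    (hv : ((p : ℕ) : NumberField.RingOfIntegers K) ∈ v.asIdeal)
    (hvbar : ((p : ℕ) : NumberField.RingOfIntegers K) ∈ vbar.asIdeal) (hne : vbar ≠ v)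
    (hιv : ∀ (w : NumberField.InfinitePlace K) (k : NumberField.RingOfIntegers K),
      k ∈ v.asIdeal ↔ ‖ι.symm (w.embedding (k : K))‖ < 1)
    (hND : IsCoprime (N : ℤ) (NumberField.discr K)) (hκ₁ : κ₁.IsCyclotomic) (hκ₂ : κ₂.IsAnticyclotomic) :
    ∃ (Ω δ : ℂ) (Ωp : (unrIntegers p)ˣ) (LK G G' : PowerSeries (PowerSeries (PadicComplexInt p))),
      Ω ≠ 0 ∧ (δ ^ 2 = (NumberField.discr K : ℂ) ∨ δ ^ 2 = -(NumberField.discr K : ℂ)) ∧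
      IsKatzMeasure₂ ι v vbar ∅ κ₁ κ₂ γ₁⁻¹ γ₂⁻¹ 1 Ω δ ((Ωp : unrIntegers p) : PadicComplex p) LK ∧
      IsGreenbergLFunctionAnyRoot₂ ι v vbar κ₁ κ₂ γ₁⁻¹ γ₂⁻¹ f (NumberField.discr K).natAbs
        (NumberField.classNumber K) LK G ∧
      IsGreenbergLFunctionAnyRoot₂ ι v vbar κ₁ κ₂ γ₁⁻¹ γ₂⁻¹ f' (NumberField.discr K).natAbs
        (NumberField.classNumber K) LK G' := by
  have hpP : p.Prime := Fact.out
  have hp2 : p ≠ 2 := by omega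
  have hgood : W.HasGoodReductionAtPrime p := hX.1.1
  have hap : W.frobeniusTrace p = 0 :=
    Summit.BirchSwinnertonDyer.Rank1Residual.Supersingular.ClassX7.frobeniusTrace_eq_zero_of_five_le W p hp5 hX
  have hpN : ¬ (p : ℤ) ∣ W.conductorNorm ℤ := fun h ↦
    (W.dvd_conductorNorm_iff_not_hasGoodReductionAtPrime p).mp (by exact_mod_cast h) hgood
  have hpd : ¬ (p : ℤ) ∣ d := not_dvd_of_ramified_ne hpP fun q hq hr ↦ (hram q hq hr).1
  have hp2d : ¬ (p : ℤ) ∣ 2 * d := not_dvd_two_mul hpP hp2 hpd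
  have hgood' : W'.HasGoodReductionAtPrime p :=
    Summit.BirchSwinnertonDyer.Rank1Residual.Supersingular.hasGoodReductionAtPrime_of_smul_eq_quadraticTwist
      W W' p hC hp2d hgood
  have hap' : W'.frobeniusTrace p = 0 := by
    rw [Summit.BirchSwinnertonDyer.Rank1Residual.Supersingular.frobeniusTrace_of_smul_eq_quadraticTwist
      W W' p hd hC hp2d hgood, hap, mul_zero]
  have hpN' : ¬ (p : ℤ) ∣ W'.conductorNorm ℤ := fun h ↦
    (W'.dvd_conductorNorm_iff_not_hasGoodReductionAtPrime p).mp (by exact_mod_cast h) hgood'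
  have hND' : IsCoprime (N' : ℤ) (NumberField.discr K) :=
    isCoprime_conductorNorm_twist_discr W W' hC hN hN' (fun q hq hr ↦ (hram q hq hr).2) hND
  exact exists_commonKatzFrame_greenberg_pair hGF ι K v vbar κ₁ κ₂ γ₁ γ₂ hp5 hK hsplit hv hvbar hne hιv hκ₁ hκ₂
    W W' hf hf' hN hpN hap hND hN' hpN' hap' hND'

end Summit.BirchSwinnertonDyer.BirchSwinnertonDyer.Theorems.SignedBaseChangeK2RFrames

end
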